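import Summits.BirchSwinnertonDyer.Rank1Residual.P2.Conjectures.CongruentNumberSilentEvenFiveAtTwo
import Summits.BirchSwinnertonDyer.Rank1Residual.P2.CongruentNumberPairsAtTwoEvenAtlasThreeTransfer
import Summits.BirchSwinnertonDyer.Rank1Residual.P2.CongruentNumberPairsAtTwoRankOneGenus
import Literature.NumberTheory.EllipticCurves.HeathBrown1994.CongruentTwoSelmerMonskyFamilies
import HarnessLib

/-!
# Cell `bsd-monsky`: `#Sel₂(E_{2pq}) = 8` on `𝒮⁻` from Monsky's EVEN matrix (Heath-Brown 1994, appendix)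
# and rank one as a KERNEL consequence — the displayed fact `h515` (Monsky 1990 Cor 5.15 + Remark (2))
# is not needed on `𝒮⁻` (nothing asserted; the conjecture `Prop`s stay `@[conjecture]`)

HONEST FRAMING (cell `bsd-monsky`, run/shared/lean/pub/bsd-monsky/, README §1: ONE theorem on ONE
explicit infinite family of quadratic twists of the congruent number curve at the prime `2`; not
"BSD for rank ≤ 1", nothing at odd primes, nothing booked until the cross-family referee passes the
written proof). This file asserts NO arithmetic fact. It replaces, on the family
`𝒮⁻ = {2pq : p ≡ 5 (mod 8), q ≡ 3 (mod 4) primes, (p/q) = −1}`, the displayed fact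
`Monsky1990.cor515_rank_eq_one_and_card_selmerGroup_two` (`h515`: rank `1` and `#Sel₂ = 8` on
Monsky's twelve families — the Selmer clause printed without proof, Remark (2) p. 67: "The very
patient reader may verify that `S̄ = ℤ/2` and `S̄* = (0)` precisely when we are in one of the 16 cases
listed in Theorems 5.13 and 5.14") by

* `#Sel₂(E_{2pq}) = 8` from Monsky's printed EVEN formula `#Sel₂ = 2^{2+s}`, `s = 2k − rank M`
  (appendix to Heath-Brown 1994, where the odd case is proved in full and the even case is "a sketch
  proof", typescript p0040 L40 – p0041 L44; tree fact `HeathBrown1994.monsky_card_selmerGroup_two_even`, `hMe`)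
  plus a KERNEL-COUNTED evaluation of the `4 × 4` matrix `M` over `𝔽₂` on `𝒮⁻` (§1: both residues
  `q ≡ 3, 7 (mod 8)`; `#ker M = 2`, so `s(2pq) = 1`), and
* rank `E_{2pq}(ℚ) = 1` as a KERNEL theorem (§2): `≤ 1` from the descent count
  `#Sel₂ = 2^{rank} · #E(ℚ)[2] · #Ш[2]` (Silverman X.4.2) with `#E(ℚ)[2] = 4`; `≥ 1` from any point
  `y ∈ E(ℚ)` with `y ∉ 2E(ℚ) + E(ℚ)_tor` — the (M-y) clause of the cell's `OddIndexHeegnerDatum`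
  (rank `0` ⟹ `E(ℚ)` finite ⟹ `y` torsion ⟹ `y = 2·0 + y`, a contradiction).

§3 is DOOR D-CN-5 (`P2.bsdp_two_congruentNumberCurve_iff_of_cor515`) with the two uses of `h515`
(rank `1`, `Ш[2^∞] = 0`) turned into hypotheses, and §4 the `h515`-free twin of
`Conjectures.congruentSilentEvenFiveBSDTwo_of_ordTwo` (rank one per member as a hypothesis, discharged
in the sequel file from the datum). This matches the written proof of record (HOME/proof/PROOF-A.md
v3.4 §7: `dim Sel₂ ≤ 3` by an explicit `2`-descent, rank one from the Heegner point; Cor 5.15 is never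
used there). The composition with the datum lives in the sequel
`P2/CongruentNumberSilentEvenFiveDatumMonskyEven.lean` (it imports the tier-0 datum module).

WHAT STAYS DISPLAYED for the `𝒮⁻` enclosure after this file: `hMe` (Heath-Brown 1994 appendix —
the standard `2`-Selmer formula, even case printed as a sketch, already the tree's input for every
`s(n)` door) instead of `h515`, and the system fact of `Tian2014/CMPointSystemGenusBridge` — nothing
else; §5 (append) offers the alternative of displaying the written proof's own load-bearing bound
`#Sel₂ ≤ 8` (PROOF-A Lemma 7.1 (a), App. D) in place of `hMe` (the glue with that binder lives in the
sequel file). Nothing asserted, no mark moved.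

References: [HeathBrown1994SelmerCongruentII] §1 (typescript p. 1 L14–L20: `#S⁽²⁾ = 2^{2+s(D)}`),
Appendix (Monsky) p. 41 L20–L36 (even `D`); [SilvermanAEC2009] Thm. X.4.2 (descent count), Thm. VIII.6.7;
[Monsky1990MockHeegner] Cor. 5.15 (p. 66), Remark (2) (p. 67) — the fact NOT used here;
[IrelandRosen1990] Ch. 5 §2 (Jacobi symbol supplements, reciprocity); [Miller2011LMS] Def. 1.1;
[KoblitzECMF1993] Ch. II §5 (root number of `E_N`).
-/

noncomputable section

open scoped Classical

open WeierstrassCurve Literature.NumberTheory.EllipticCurves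
  Literature.NumberTheory.EllipticCurves.Rank1Residual
  Literature.NumberTheory.EllipticCurves.Rank1Residual.Typed
  Literature.NumberTheory.EllipticCurves.HeathBrown1994
  Literature.NumberTheory.EllipticCurves.HeathBrown1994.Families
  Literature.NumberTheory.EllipticCurves.Monsky1990

set_option autoImplicit false

namespace Summit.BirchSwinnertonDyer.Rank1Residual.P2

open Conjectures

/-! ## §1 Monsky's even matrix on `𝒮⁻`: `#ker M = 2`, i.e. `s(2pq) = 1` (kernel-decided) -/

section SMinusMatrix

variable {p q : ℕ}

/-- On `𝒮⁻`, `(q/p) = (p/q) = −1` (quadratic reciprocity, `p ≡ 1 (mod 4)`).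
[cite: IrelandRosen1990, Ch. 5 §2 Thm. 1 (reciprocity for the Jacobi symbol)] -/
theorem jacobiSym_swap_two_mul_five_mul (hq : q.Prime) (hp4 : p % 4 = 1) (hq2 : q ≠ 2)
    (hpq : jacobiSym (p : ℤ) q = -1) : jacobiSym (q : ℤ) p = -1 := by
  rw [jacobiSym.quadratic_reciprocity_one_mod_four' (hq.odd_of_ne_two hq2) hp4, hpq]

/-- **Monsky's even matrix on `𝒮⁻`, `q ≡ 3 (mod 8)`**: with `A = (1 1; 1 1)` (`(q/p) = (p/q) = −1`),
`D₂ = I` (`(2/p) = (2/q) = −1`), `D₋₁ = diag(0, 1)` (`(−1/p) = 1`, `(−1/q) = −1`):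
`M = ( Aᵀ + D₂  D₋₁ ; D₂  A + D₂ ) = ( 0 1 0 0 ; 1 0 0 1 ; 1 0 0 1 ; 0 1 1 0 )`.
[cite: HeathBrown1994SelmerCongruentII, Appendix (Monsky), typescript p. 41 L20–L36 (the matrix; evaluation ours)] -/
theorem monskyMatrixEven_two_mul_five_three (hp : p.Prime) (hq : q.Prime) (hp8 : p % 8 = 5)
    (hq8 : q % 8 = 3) (hpq : jacobiSym (p : ℤ) q = -1) :
    monskyMatrixEven ![p, q] = (Matrix.fromBlocks !![0, 1; 1, 0] !![0, 0; 0, 1] !![1, 0; 0, 1]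
      !![0, 1; 1, 0] : Matrix (Fin 2 ⊕ Fin 2) (Fin 2 ⊕ Fin 2) (ZMod 2)) := by
  have h3 : jacobiSym 2 p = -1 := jacobiSym_two_eq_neg_one (Or.inr hp8)
  have h4 : jacobiSym (-1) p = 1 := jacobiSym_neg_one_eq_one (by omega)
  have h5 : jacobiSym 2 q = -1 := jacobiSym_two_eq_neg_one (Or.inl hq8)
  have h6 : jacobiSym (-1) q = -1 := DeuringLadic.jacobiSym_neg_one_of_mod_four (by omega)
  have h7 : jacobiSym (p : ℤ) p = 0 := Families.jacobiSym_self hp.one_lt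
  have h8 : jacobiSym (q : ℤ) q = 0 := Families.jacobiSym_self hq.one_lt
  have h1 : jacobiSym (q : ℤ) p = -1 := jacobiSym_swap_two_mul_five_mul hq (by omega) (by omega) hpq
  ext i j
  rcases i with i | i <;> rcases j with j | j <;> fin_cases i <;> fin_cases j <;>
    (simp [monskyMatrixEven, legendreMatrix, legendreDiagonal, addLegendreSym, Matrix.fromBlocks,
      Matrix.diagonal, Matrix.transpose, Finset.sum_erase_eq_sub, Fin.sum_univ_succ, h1, hpq, h3, h4,
      h5, h6, h7, h8]; try decide)

/-- **Monsky's even matrix on `𝒮⁻`, `q ≡ 7 (mod 8)`**: now `(2/q) = 1`, so `D₂ = diag(1, 0)`: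
`M = ( 0 1 0 0 ; 1 1 0 1 ; 1 0 0 1 ; 0 0 1 1 )`.
[cite: HeathBrown1994SelmerCongruentII, Appendix (Monsky), typescript p. 41 L20–L36 (the matrix; evaluation ours)] -/
theorem monskyMatrixEven_two_mul_five_seven (hp : p.Prime) (hq : q.Prime) (hp8 : p % 8 = 5)
    (hq8 : q % 8 = 7) (hpq : jacobiSym (p : ℤ) q = -1) :
    monskyMatrixEven ![p, q] = (Matrix.fromBlocks !![0, 1; 1, 1] !![0, 0; 0, 1] !![1, 0; 0, 0]
      !![0, 1; 1, 1] : Matrix (Fin 2 ⊕ Fin 2) (Fin 2 ⊕ Fin 2) (ZMod 2)) := by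
  have h3 : jacobiSym 2 p = -1 := jacobiSym_two_eq_neg_one (Or.inr hp8)
  have h4 : jacobiSym (-1) p = 1 := jacobiSym_neg_one_eq_one (by omega)
  have h5 : jacobiSym 2 q = 1 := jacobiSym_two_eq_one (Or.inr hq8)
  have h6 : jacobiSym (-1) q = -1 := DeuringLadic.jacobiSym_neg_one_of_mod_four (by omega)
  have h7 : jacobiSym (p : ℤ) p = 0 := Families.jacobiSym_self hp.one_lt
  have h8 : jacobiSym (q : ℤ) q = 0 := Families.jacobiSym_self hq.one_lt
  have h1 : jacobiSym (q : ℤ) p = -1 := jacobiSym_swap_two_mul_five_mul hq (by omega) (by omega) hpq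
  ext i j
  rcases i with i | i <;> rcases j with j | j <;> fin_cases i <;> fin_cases j <;>
    (simp [monskyMatrixEven, legendreMatrix, legendreDiagonal, addLegendreSym, Matrix.fromBlocks,
      Matrix.diagonal, Matrix.transpose, Finset.sum_erase_eq_sub, Fin.sum_univ_succ, h1, hpq, h3, h4,
      h5, h6, h7, h8]; try decide)

/-- **`s(2pq) = 1` on `𝒮⁻` is a THEOREM** (no named fact): Monsky's even matrix has a `2`-element
kernel in both residue cases (`{0, (1,0,0,1)}` for `q ≡ 3`, `{0, (1,0,1,1)}` for `q ≡ 7 (mod 8)`;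
`decide`), so `s = 2·2 − rank M = 1` (`monskySelmerRankEven_eq_one_iff_card_ker`).
[cite: HeathBrown1994SelmerCongruentII, Appendix (Monsky), typescript p. 41 L36 (`s(D) = 2Ω(D₀) − rank M₁`)] -/
theorem monskySelmerRankEven_two_mul_five_mul (hp : p.Prime) (hq : q.Prime) (hp8 : p % 8 = 5)
    (hq4 : q % 4 = 3) (hpq : jacobiSym (p : ℤ) q = -1) : monskySelmerRankEven ![p, q] = 1 := by
  rw [monskySelmerRankEven_eq_one_iff_card_ker]
  rcases (by omega : q % 8 = 3 ∨ q % 8 = 7) with hq8 | hq8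
  · rw [monskyMatrixEven_two_mul_five_three hp hq hp8 hq8 hpq]; decide
  · rw [monskyMatrixEven_two_mul_five_seven hp hq hp8 hq8 hpq]; decide

/-- **`#Sel₂(E_{2pq}) = 8` on `𝒮⁻`, from Monsky's even formula alone** (`hMe`: `#Sel₂ = 2^{2+s}` for
`2pq`, distinct odd primes) and the kernel count `s(2pq) = 1` above. No Cor 5.15.
[cite: HeathBrown1994SelmerCongruentII, §1 (typescript p. 1 L14–L20), Appendix (Monsky) p. 41 L20–L36] -/
theorem card_selmerGroup_two_two_mul_five_mul (hMe : monsky_card_selmerGroup_two_even)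
    (hp : p.Prime) (hq : q.Prime) (hp8 : p % 8 = 5) (hq4 : q % 4 = 3)
    (hpq : jacobiSym (p : ℤ) q = -1) :
    Nat.card ((congruentNumberCurve (2 * (p * q))).selmerGroup 2) = 8 := by
  have hne : p ≠ q := fun h => by omega
  have hP : ∀ i, (![p, q] i).Prime := fun i => by fin_cases i <;> assumption
  have hodd : ∀ i, Odd (![p, q] i) := fun i => by
    fin_cases i
    · exact hp.odd_of_ne_two (by omega)
    · exact hq.odd_of_ne_two (by omega)
  have h := hMe 2 ![p, q] hP hodd (injective_vecPair hne)
  rw [monskySelmerRankEven_two_mul_five_mul hp hq hp8 hq4 hpq] at h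
  have hprod : 2 * ∏ i, ![p, q] i = 2 * (p * q) := by simp [Fin.prod_univ_two]
  -- transport along `hprod` with an explicit function (the Selmer group carries dependent instances)
  have key := congrArg (fun n : ℕ => Nat.card ((congruentNumberCurve n).selmerGroup 2)) hprod
  exact key.symm.trans (h.trans (by norm_num))

end SMinusMatrix

/-! ## §2 Rank one as a kernel theorem: `≤ 1` from `#Sel₂ = 8`, `≥ 1` from a non-halvable point -/

section RankOne

variable {N : ℕ}

/-- **`#Sel₂(E_N) = 8` ⟹ rank `E_N(ℚ) ≤ 1`**: the descent count `#Sel₂ = 2^{rank}·#E_N(ℚ)[2]·#(Ш ⊓ H¹[2])`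
(Silverman X.4.2) with `#E_N(ℚ)[2] = 4` reads `8 = 2^{rank}·4·S`, `S ≥ 1`.
[cite: SilvermanAEC2009, Thm. X.4.2] -/
theorem mordellWeilRank_le_one_of_card_selmerGroup_two_eq_eight (hN : N ≠ 0)
    (hsel : Nat.card ((congruentNumberCurve N).selmerGroup 2) = 8) :
    (congruentNumberCurve N).mordellWeilRank ≤ 1 := by
  haveI := isElliptic_congruentNumberCurve hN
  haveI : Fact (Nat.Prime 2) := ⟨Nat.prime_two⟩
  have hsel' : Nat.card ((congruentNumberCurve N).selmerGroup ((2 : ℕ) : ℤ)) = 8 := by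
    simpa only [Nat.cast_ofNat] using hsel
  have hcard := (congruentNumberCurve N).natCard_selmerGroup_eq (n := 2) two_ne_zero
  rw [hsel'] at hcard
  have aux : ∀ {r T S : ℕ}, 8 = 2 ^ r * T * S → T = 4 → r ≤ 1 := by
    intro r T S hTS hT
    subst hT
    by_contra hlt
    have h2r : 2 ≤ r := by omega
    have hS : 0 < S := Nat.pos_of_ne_zero (by rintro rfl; simp at hTS)
    have h4 : 2 ^ 2 ≤ 2 ^ r := Nat.pow_le_pow_right (by norm_num) h2r
    have : 2 ^ 2 * 4 * 1 ≤ 2 ^ r * 4 * S := Nat.mul_le_mul (Nat.mul_le_mul h4 le_rfl) hS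
    omega
  exact aux hcard (by convert Smith2016.natCard_torsionBy_two_congruentNumberCurve hN; norm_num)

/-- **A point outside `2E_N(ℚ) + E_N(ℚ)_tor` forces rank `≥ 1`**: if the rank were `0`, `E_N(ℚ)` would
be finite (Mordell–Weil, `finite_point_of_rank_zero`), so `y` itself torsion and `y = 2·0 + y` — the
excluded shape. Stated for an arbitrary `[DecidableEq ℚ]` on the group law (the datum's idiom).
[cite: SilvermanAEC2009, Thm. VIII.6.7] -/
theorem mordellWeilRank_ne_zero_of_not_two_smul_add_torsion [DecidableEq ℚ] (hN : N ≠ 0)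
    (y : (congruentNumberCurve N).toAffine.Point)
    (hy : ∀ z t : (congruentNumberCurve N).toAffine.Point, IsOfFinAddOrder t →
      y ≠ (2 : ℤ) • z + t) :
    (congruentNumberCurve N).mordellWeilRank ≠ 0 := by
  haveI := isElliptic_congruentNumberCurve hN
  intro h0
  haveI : Finite (congruentNumberCurve N).toAffine.Point := finite_point_of_rank_zero _ h0
  exact hy 0 y (isOfFinAddOrder_of_finite y) (by rw [zsmul_zero, zero_add])

/-- **Rank `E_N(ℚ) = 1` from `#Sel₂ = 8` and a non-halvable point** (the two bounds above). This is
exactly the rank clause of Monsky's Cor 5.15 (2′) on `𝒮⁻`, obtained in the kernel from the Selmer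
count and the (M-y) clause of the datum instead of from the printed fact.
[cite: SilvermanAEC2009, Thm. X.4.2, Thm. VIII.6.7] -/
theorem mordellWeilRank_eq_one_of_card_selmerGroup_two_eq_eight [DecidableEq ℚ] (hN : N ≠ 0)
    (hsel : Nat.card ((congruentNumberCurve N).selmerGroup 2) = 8)
    (y : (congruentNumberCurve N).toAffine.Point)
    (hy : ∀ z t : (congruentNumberCurve N).toAffine.Point, IsOfFinAddOrder t →
      y ≠ (2 : ℤ) • z + t) :
    (congruentNumberCurve N).mordellWeilRank = 1 :=
  le_antisymm (mordellWeilRank_le_one_of_card_selmerGroup_two_eq_eight hN hsel)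
    (Nat.one_le_iff_ne_zero.mpr (mordellWeilRank_ne_zero_of_not_two_smul_add_torsion hN y hy))

end RankOne

/-! ## §3 DOOR D-CN-5 with rank one and `Ш[2^∞] = 0` as HYPOTHESES (no `h515`) -/

/-- **DOOR D-CN-5, fact-free form.** `N` in Monsky's Cor 5.15 families (membership only:
`IsCor515Family N`, giving `N ≠ 0`, square-free, `N ≡ 5, 6, 7 (mod 8)`), rank `E_N(ℚ) = 1` (`hrank`),
`Ш(E_N)[2^∞] = 0` (`hbot`), `#E_N(ℚ)_tor = 4` (`ht`) and a rank-one datum `L′(E_N,1) = x·Ω·Reg`,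
`x ≠ 0`: THEN `ord_{s=1} L(E_N,s) = 1` and `BSD(E_N, 2) ⟺ ord₂ x = ord₂ ∏c_ℓ(E_N) − 4`. The proof of
`P2.bsdp_two_congruentNumberCurve_iff_of_cor515` verbatim with its two uses of `h515` replaced by the
hypotheses. No GZK / Kolyvagin / modularity binder.
[cite: Miller2011LMS, Def. 1.1 (arXiv:1010.2431 p. 3)] [cite: KoblitzECMF1993, Ch. II §5, Theorem (p. 84)] -/
theorem bsdp_two_congruentNumberCurve_iff_of_rank_one_of_sha_two_eq_bot {N : ℕ}
    (hN : IsCor515Family N)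
    (hrank : (congruentNumberCurve N).mordellWeilRank = 1)
    (hbot : haveI := isElliptic_congruentNumberCurve hN.ne_zero;
      AddCommGroup.primaryComponent (congruentNumberCurve N).sha 2 = ⊥)
    (ht : (congruentNumberCurve N).torsionOrder = 4) {x : ℚ} (hx0 : x ≠ 0)
    (hx : deriv (congruentNumberCurve N).entireLFunction 1 =
      (x : ℂ) * ((congruentNumberCurve N).realPeriodRat : ℂ) *
        ((congruentNumberCurve N).regulator : ℂ)) :
    haveI := isElliptic_congruentNumberCurve hN.ne_zero
    (congruentNumberCurve N).analyticRank = 1 ∧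
      (BSDp (congruentNumberCurve N) 2 ↔
        padicValRat 2 x = (padicValNat 2 (congruentNumberCurve N).tamagawaProduct : ℤ) - 4) := by
  have hn : N ≠ 0 := hN.ne_zero
  have hsq : Squarefree N := hN.squarefree
  haveI := isElliptic_congruentNumberCurve hn
  haveI : Fact (2 : ℕ).Prime := ⟨Nat.prime_two⟩
  -- root number + `x ≠ 0`: `r_an = 1`
  have hΩ : ((congruentNumberCurve N).realPeriodRat : ℂ) ≠ 0 := by
    exact_mod_cast (congruentNumberCurve N).realPeriodRat_pos_holds.ne'
  have hR : ((congruentNumberCurve N).regulator : ℂ) ≠ 0 := by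
    exact_mod_cast (congruentNumberCurve N).regulator_pos'.ne'
  have hder : deriv (congruentNumberCurve N).entireLFunction 1 ≠ 0 := by
    rw [hx]
    exact mul_ne_zero (mul_ne_zero (by exact_mod_cast hx0) hΩ) hR
  have hr1 : (congruentNumberCurve N).analyticRank = 1 :=
    analyticRank_congruentNumberCurve_eq_one_of_deriv_ne_zero hsq hN.mod_eight hder
  refine ⟨hr1, ?_⟩
  -- `#Ш_an = x · 16 / ∏c_ℓ`
  have hL : (congruentNumberCurve N).leadingLCoeff =
      (x : ℂ) * ((congruentNumberCurve N).realPeriodRat : ℂ) *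
        ((congruentNumberCurve N).regulator : ℂ) := by
    rw [(leadingLCoeff_eq_deriv_of_analyticRank_eq_one hr1).1, hx]
  have hsha := shaAn_eq_of_leadingLCoeff (congruentNumberCurve N) hL
  have hcard : Nat.card (AddCommGroup.primaryComponent (congruentNumberCurve N).sha 2) = 1 := by
    rw [hbot]; exact AddSubgroup.card_bot
  have hc : ((congruentNumberCurve N).tamagawaProduct : ℚ) ≠ 0 := by
    exact_mod_cast (congruentNumberCurve N).tamagawaProduct_pos_holds.ne'
  have h16 : padicValRat 2 (((4 : ℕ) : ℚ) ^ 2) = 4 := by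
    rw [show (((4 : ℕ) : ℚ)) ^ 2 = ((2 ^ 4 : ℕ) : ℚ) by norm_num, padicValRat.of_nat,
      padicValNat.prime_pow]
    norm_num
  have hval : padicValRat 2 (x * ((congruentNumberCurve N).torsionOrder : ℚ) ^ 2 /
      ((congruentNumberCurve N).tamagawaProduct : ℚ)) =
      padicValRat 2 x + 4 - padicValNat 2 (congruentNumberCurve N).tamagawaProduct := by
    rw [ht, padicValRat.div (mul_ne_zero hx0 (by norm_num)) hc, padicValRat.mul hx0 (by norm_num),
      padicValRat.of_nat, h16]
  -- Miller's `BSD(E,2)` unfolded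
  rw [bsdp_iff]
  constructor
  · rintro ⟨-, -, q, hq, hv⟩
    have hqq : q = x * ((congruentNumberCurve N).torsionOrder : ℚ) ^ 2 /
        ((congruentNumberCurve N).tamagawaProduct : ℚ) :=
      Rat.cast_injective (α := ℂ) (hq.symm.trans hsha)
    rw [hqq, hval, hcard] at hv
    simp only [padicValNat_one_right, Nat.cast_zero] at hv
    linarith
  · intro hv
    refine ⟨by rw [hrank, hr1], by rw [hbot]; infer_instance, _, hsha, ?_⟩
    rw [hval, hcard]
    simp only [padicValNat_one_right, Nat.cast_zero]
    linarith

/-! ## §4 The `h515`-free twin of `congruentSilentEvenFiveBSDTwo_of_ordTwo` -/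

/-- **Sharper ⟹ observable on `𝒮⁻`, modulo `hMe` and rank one per member** (no Cor 5.15): for every
`(p, q)` of `𝒮⁻`, `#Sel₂ = 8` (§1) and rank `1` (`hrank`) give `Ш[2^∞] = 0`
(`primaryComponent_sha_two_eq_bot_of_card_selmerGroup_eq_eight`), and the fact-free door (§3) turns
`ord₂ x = 2` into `ord_{s=1} L = 1 ∧ BSD(E_{2pq}, 2)` (`∏c_ℓ = 2⁶`). A kernel implication between
conjecture `Prop`s; asserts neither. In the sequel file `hrank` is discharged from the datum (§2).
[cite: HeathBrown1994SelmerCongruentII, Appendix (Monsky), typescript p. 41 L20–L36]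
[cite: SilvermanAEC2009, Thm. X.4.2] [cite: Miller2011LMS, Def. 1.1 (arXiv:1010.2431 p. 3)] -/
theorem congruentSilentEvenFiveBSDTwo_of_ordTwo_of_monskyEven
    (hMe : monsky_card_selmerGroup_two_even)
    (hrank : ∀ p q : ℕ, p.Prime → q.Prime → p % 8 = 5 → q % 4 = 3 → jacobiSym p q = -1 →
      (congruentNumberCurve (2 * (p * q))).mordellWeilRank = 1)
    (h : CongruentSilentEvenFiveOrdTwo) : CongruentSilentEvenFiveBSDTwo := by
  intro p q hp hq hp5 hq4 hj
  obtain ⟨hN, hp2, hq2, hne⟩ := isCor515Family_two_mul_five_mul hp hq hp5 hq4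
  haveI : Fact (Nat.Prime 2) := ⟨Nat.prime_two⟩
  obtain ⟨x, hx0, hx, hv⟩ := h p q hp hq hp5 hq4 hj
  obtain ⟨-, htam⟩ := twoExponent_tamagawa_two_mul_prime_mul hp hq hp2 hq2 hne
  have hr := hrank p q hp hq hp5 hq4 hj
  have hsel := card_selmerGroup_two_two_mul_five_mul hMe hp hq hp5 hq4 hj
  have hbot := primaryComponent_sha_two_eq_bot_of_card_selmerGroup_eq_eight hN.ne_zero hr hsel
  obtain ⟨hr1, hiff⟩ := bsdp_two_congruentNumberCurve_iff_of_rank_one_of_sha_two_eq_bot hN hr hbot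
    (torsionOrder_congruentNumberCurve hN.squarefree) hx0 hx
  refine ⟨hr1, hiff.mpr ?_⟩
  rw [hv, htam, padicValNat.prime_pow]
  norm_num

/-! ## §5 (append, g5) The written proof's own Selmer input: `#Sel₂ ≤ 8` instead of `hMe` -/

section SelmerLeEight

variable {N : ℕ}

/-- **`#Sel₂(E_N) ≤ 8` ⟹ rank `E_N(ℚ) ≤ 1`** — the shape of PROOF-A Lemma 7.1 (a) / Cor. 7.2 (1): the
descent count `#Sel₂ = 2^{rank}·#E_N(ℚ)[2]·#(Ш ⊓ H¹[2])` with `#E_N(ℚ)[2] = 4`, `#Sel₂ ≥ 1` (finite,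
non-empty) and `#Sel₂ ≤ 8` force `2^{rank} ≤ 2`. [cite: SilvermanAEC2009, Thm. X.4.2] -/
theorem mordellWeilRank_le_one_of_card_selmerGroup_two_le_eight (hN : N ≠ 0)
    (hsel : Nat.card ((congruentNumberCurve N).selmerGroup 2) ≤ 8) :
    (congruentNumberCurve N).mordellWeilRank ≤ 1 := by
  haveI := isElliptic_congruentNumberCurve hN
  haveI : Fact (Nat.Prime 2) := ⟨Nat.prime_two⟩
  have hsel' : Nat.card ((congruentNumberCurve N).selmerGroup ((2 : ℕ) : ℤ)) ≤ 8 := by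
    simpa only [Nat.cast_ofNat] using hsel
  haveI : Finite ((congruentNumberCurve N).selmerGroup ((2 : ℕ) : ℤ)) :=
    (congruentNumberCurve N).finite_selmerGroup_holds (by norm_num)
  have hpos : 0 < Nat.card ((congruentNumberCurve N).selmerGroup ((2 : ℕ) : ℤ)) := Nat.card_pos
  have hcard := (congruentNumberCurve N).natCard_selmerGroup_eq (n := 2) two_ne_zero
  have aux : ∀ {C r T S : ℕ}, C = 2 ^ r * T * S → T = 4 → 0 < C → C ≤ 8 → r ≤ 1 := by
    intro C r T S hTS hT hC0 hC8
    subst hT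
    by_contra hlt
    have h2r : 2 ≤ r := by omega
    have hS : 0 < S := Nat.pos_of_ne_zero (by rintro rfl; simp at hTS; omega)
    have h4 : 2 ^ 2 ≤ 2 ^ r := Nat.pow_le_pow_right (by norm_num) h2r
    have : 2 ^ 2 * 4 * 1 ≤ 2 ^ r * 4 * S := Nat.mul_le_mul (Nat.mul_le_mul h4 le_rfl) hS
    omega
  exact aux hcard (by convert Smith2016.natCard_torsionBy_two_congruentNumberCurve hN; norm_num) hpos hsel'

/-- **`#Sel₂(E_N) ≤ 8` and a point outside `2E_N(ℚ) + tor` ⟹ rank `1`, `#Sel₂ = 8` and `Ш(E_N)[2^∞] = 0`** —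
PROOF-A Cor. 7.2 (1)–(2) in tree currency: rank `≥ 1` from the point, `≤ 1` from the bound, and then the
descent count reads `8 ≥ #Sel₂ = 2·4·#Ш[2] ≥ 8`, so `#Sel₂ = 8` and `Ш[2] = 0`. With this, the enclosure's
`2`-Selmer input can be the written proof's own bound (App. D) instead of `hMe`.
[cite: SilvermanAEC2009, Thm. X.4.2, Thm. VIII.6.7] -/
theorem rank_eq_one_card_selmerGroup_two_eq_eight_sha_of_le_eight [DecidableEq ℚ] (hN : N ≠ 0)
    (hsel : Nat.card ((congruentNumberCurve N).selmerGroup 2) ≤ 8)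
    (y : (congruentNumberCurve N).toAffine.Point)
    (hy : ∀ z t : (congruentNumberCurve N).toAffine.Point, IsOfFinAddOrder t →
      y ≠ (2 : ℤ) • z + t) :
    (congruentNumberCurve N).mordellWeilRank = 1 ∧
      Nat.card ((congruentNumberCurve N).selmerGroup 2) = 8 ∧
      AddCommGroup.primaryComponent (congruentNumberCurve N).sha 2 = ⊥ := by
  have hrank : (congruentNumberCurve N).mordellWeilRank = 1 :=
    le_antisymm (mordellWeilRank_le_one_of_card_selmerGroup_two_le_eight hN hsel)
      (Nat.one_le_iff_ne_zero.mpr (mordellWeilRank_ne_zero_of_not_two_smul_add_torsion hN y hy))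
  haveI := isElliptic_congruentNumberCurve hN
  haveI : Fact (Nat.Prime 2) := ⟨Nat.prime_two⟩
  have hsel' : Nat.card ((congruentNumberCurve N).selmerGroup ((2 : ℕ) : ℤ)) ≤ 8 := by
    simpa only [Nat.cast_ofNat] using hsel
  haveI : Finite ((congruentNumberCurve N).selmerGroup ((2 : ℕ) : ℤ)) :=
    (congruentNumberCurve N).finite_selmerGroup_holds (by norm_num)
  have hpos : 0 < Nat.card ((congruentNumberCurve N).selmerGroup ((2 : ℕ) : ℤ)) := Nat.card_pos
  have hcard := (congruentNumberCurve N).natCard_selmerGroup_eq (n := 2) two_ne_zero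
  rw [hrank, pow_one] at hcard
  have aux : ∀ {C T S : ℕ}, C = 2 * T * S → T = 4 → 0 < C → C ≤ 8 → C = 8 := by
    intro C T S hTS hT hC0 hC8
    subst hT
    omega
  have h8 : Nat.card ((congruentNumberCurve N).selmerGroup ((2 : ℕ) : ℤ)) = 8 :=
    aux hcard (by convert Smith2016.natCard_torsionBy_two_congruentNumberCurve hN; norm_num) hpos hsel'
  have h8' : Nat.card ((congruentNumberCurve N).selmerGroup 2) = 8 := by
    simpa only [Nat.cast_ofNat] using h8
  exact ⟨hrank, h8', primaryComponent_sha_two_eq_bot_of_card_selmerGroup_eq_eight hN hrank h8'⟩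

end SelmerLeEight

end Summit.BirchSwinnertonDyer.Rank1Residual.P2

end
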